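import Mathlib
import HarnessLib
import Summits.HubbardSuperconductivity.HubbardSuperconductivity.Theorems.KLProgrammeFermiSurfaceFST2Global
import Summits.HubbardSuperconductivity.HubbardSuperconductivity.Theorems.KLProgrammeFermiSurfaceFST2Constants

/-!
# Route `KLProgramme` (cruxes K3/K1, risk r2): FST II Theorem 1.1 (the two-loop volume bound `VolumeBound`,
# AS TYPED in `FermiRG/FST2Regularity.lean`) is instantiable at the Hubbard band on the Kohn–Luttinger window —
# all its hypotheses are discharged; the conclusion, CONDITIONAL on the named fact, with ONE constant on the window

Cell `gate-hubbard-kl`, seat fs-1, risk-register item r2. Feldman–Salmhofer–Trubowitz II, Theorem 1.1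
(`𝓦(ε) ≤ Q_V ε |log ε|` in `d = 2`) is typed as the named fact `FermiRG.VolumeBound` (F-026; not proved in the
tree) with hypotheses (A2)_{2,0}, (A3) local + global, (A4) and the geometric constants `GeomConstants e K r₀ g₀ wmin`,
ONE `Q` serving every `e` with the same crystal and constants. Unlike the statements that carry the filling
restriction (A5) — `LemmaFindCP`, `SecondOrderRegularity`, FST III Thm 1.1 (i), FST IV Thm 1 — every one of
these hypotheses is PROVED for the Hubbard band `e = ε - μ` on `Crystal.cubic 2` (`klfs_hypA2`, `klfs_hypA3`,
`klfs_hypA3Global`, `klfs_hypA4`, `klfs_geomConstants` / `klfs_window_geomConstants`). Hence: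

* `klfs_fst2_volumeBound_hubbard`: `VolumeBound →` for every `-8/3 < μ < 0` there is `Q ≥ 1` with
  `volW (cubic 2) (ε - μ) ε' ≤ Q ε' |log ε'|` for `0 < ε' ≤ 1/2`;
* `klfs_fst2_volumeBound_window`: `VolumeBound →` ONE `Q ≥ 1` serves the whole certified window
  `μ ∈ [-0.4267, -0.1798]` (the window constants `(4.4267, 0.0899, 0.579, 0.0449)` are `μ`-uniform).

Nothing is asserted about `VolumeBound` itself. No definitions; everything PROVED. [folklore]
-/

noncomputable section

open Real Set

-- the tree's namespace `Summit.<Summit>.<Problem>.Theorems` repeats the summit name by design (D-0017)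
set_option linter.dupNamespace false

namespace Summit.HubbardSuperconductivity.HubbardSuperconductivity.Theorems

open Literature.MathematicalPhysics.QuantumLattice

/-- **FST II Theorem 1.1 for the Hubbard band, conditional on the typed fact**: if `VolumeBound` holds then
for every `-8/3 < μ < 0` (in particular on both programme windows) there is `Q ≥ 1` with
`𝓦(ε') ≤ Q ε' |log ε'|`, `0 < ε' ≤ 1/2`, for `e = ε - μ` on `Crystal.cubic 2` — all hypotheses of the typed
theorem are discharged by `klfs_hypA2/A3/A3Global/A4` and `klfs_geomConstants`. [folklore] -/
theorem klfs_fst2_volumeBound_hubbard (hV : FermiRG.VolumeBound) {μ : ℝ} (hμ₁ : -8 / 3 < μ) (hμ₂ : μ < 0) :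
    ∃ Q : ℝ, 1 ≤ Q ∧ ∀ ε' : ℝ, 0 < ε' → ε' ≤ 1 / 2 →
      FermiRG.volW (FermiRG.Crystal.cubic 2) (fun q : Momentum => squareDispersion 1 0 q - μ) ε' ≤
        ENNReal.ofReal (Q * ε' * |Real.log ε'|) := by
  obtain ⟨Q, hQ, h⟩ := hV Momentum (FermiRG.Crystal.cubic 2) (4 + |μ|) (-μ / 2)
    (Real.sqrt (-μ / 2 * (4 + 3 * μ / 2))) (-μ / 4)
  refine ⟨Q, hQ, fun ε' hε hε' => ?_⟩
  have hμ₁' : -4 < μ := by linarith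
  exact (h _ (klfs_hypA2 hμ₁' hμ₂ 2) (klfs_hypA3 hμ₁' hμ₂) (klfs_hypA3Global hμ₁' hμ₂) (klfs_hypA4 hμ₂)
    (klfs_geomConstants hμ₁ hμ₂) ε' hε hε').1 (by simp)

/-- **One constant on the certified window**: if `VolumeBound` holds then a SINGLE `Q ≥ 1` gives
`𝓦(ε') ≤ Q ε' |log ε'|` (`0 < ε' ≤ 1/2`) for every `μ ∈ [-0.4267, -0.1798]` — the geometric constants
`(K, r₀, g₀, wmin) = (4.4267, 0.0899, 0.579, 0.0449)` of `klfs_window_geomConstants` are uniform on the window, and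
FST's `Q_V` depends on nothing else. [folklore] -/
theorem klfs_fst2_volumeBound_window (hV : FermiRG.VolumeBound) :
    ∃ Q : ℝ, 1 ≤ Q ∧ ∀ μ ∈ Icc (-0.4267 : ℝ) (-0.1798), ∀ ε' : ℝ, 0 < ε' → ε' ≤ 1 / 2 →
      FermiRG.volW (FermiRG.Crystal.cubic 2) (fun q : Momentum => squareDispersion 1 0 q - μ) ε' ≤
        ENNReal.ofReal (Q * ε' * |Real.log ε'|) := by
  obtain ⟨Q, hQ, h⟩ := hV Momentum (FermiRG.Crystal.cubic 2) 4.4267 0.0899 0.579 0.0449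
  refine ⟨Q, hQ, fun μ hμ ε' hε hε' => ?_⟩
  have hμ₁ : -4 < μ := by linarith [hμ.1]
  have hμ₂ : μ < 0 := by linarith [hμ.2]
  exact (h _ (klfs_hypA2 hμ₁ hμ₂ 2) (klfs_hypA3 hμ₁ hμ₂) (klfs_hypA3Global hμ₁ hμ₂) (klfs_hypA4 hμ₂)
    (klfs_window_geomConstants hμ) ε' hε hε').1 (by simp)

end Summit.HubbardSuperconductivity.HubbardSuperconductivity.Theorems

end
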